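import Mathlib.Analysis.SpecialFunctions.Pow.Real

/-!
# Red-shift on the face collar of near-extremal Kerr — I: real algebra

Helper file for the stub `stub_faceRedShift` (S2) of the line `unit-temperature-front-face` for the
crux `NearExtremalKappaCapture` (route `PhaseMixingCapture`, item stmt-FinalStateConjecture-10606).

The stub propagates the `κ`-explicit Dafermos–Rodnianski red-shift of
`Literature/Geometry/Lorentzian/KerrRedShiftHorizon.lean` (`Kerr.redShift_horizon_coercive_kappa`,
valid ON the horizon `r = r₊`) to the collar `|r − r₊| ≤ θ₀ (r₊ − r₋)` of blown-up width
`θ₀ = 10⁻⁴`, with multiplier parameters `h₁ = f₁ = 64/s`, `s = √(M² − a²) = (r₊ − r₋)/2`, and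
coercivity `κ/32`, uniformly on `|a| < M`. This file contains the pure real algebra:

* `main_form_lower` — the horizon-shaped form
  `2H h λ² + ½ f Q + cf·Rt·v² − cf(4Hr/Σ)λv + cf(2r/Σ)vA` dominates `¼hλ² + ⅛fQ + ½cf·Rt·v²`
  under `H ∈ [¼, 5/4]`, `cf ∈ [½, 3/2]`, `A² ≤ Q·Dr`, `Dr ≤ 1`, `r² ≤ Σ` and the thresholds
  `h Σ Rt ≥ 32`, `f Σ Rt ≥ 16` (generalisation of `Kerr.redShift_horizon_algebra`, where `cf = 1`,
  `2H = 1 + Dr`, `Σ Rt = r₊ − M`);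
* elementary absolute-value bookkeeping (`neg_mul_le_mul_of_abs_le`, `abs_quad_le`, `abs_lin_le`);
* the two collar smallness estimates: `|Δ| = |r² − 2Mr + a²| ≤ s²/2000` (`abs_delta_le`) and
  `|a − (r² + a²)ω₊| ≤ s/4000` (`abs_eps1_num_le`) for `|r − (M + s)| ≤ s/5000`;
* the bound `|Π| ≤ 2|B| + 2M|λ|` for the axial component `Π = x₁p₂ − x₂p₁` (`abs_Pi_le`) and the
  Young-inequality bookkeeping `prod_PW_le` for the product of the `Π`- and `W`-bounds.

All statements are inequalities between real numbers; no geometry is imported.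
-/

noncomputable section

-- the doubled `FinalStateConjecture.FinalStateConjecture` path component trips dupNamespace
set_option linter.dupNamespace false

namespace Summit.FinalStateConjecture.FinalStateConjecture.Theorems.NearExtremalKappaCapture.UnitTemperatureFrontFace

/-! ### The main (horizon-shaped) form -/

/-- **Main form, generalised horizon algebra.** With `S = Σ > 0`, `r² ≤ S`, `0 ≤ Dr ≤ 1`
(`Dr = |∇̸r|²`), `0 ≤ Q`, `A² ≤ Q·Dr` (Cauchy–Schwarz), `H ∈ [1/4, 5/4]`, a positive transversal
coefficient `Rt`, a weight `cf ∈ [1/2, 3/2]` and thresholds `32 ≤ h S Rt`, `16 ≤ f S Rt`, the form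
`2H h λ² + ½ f Q + cf Rt v² − cf (4Hr/S) λ v + cf (2r/S) v A` dominates
`¼ h λ² + ⅛ f Q + ½ cf Rt v²` (each cross term costs `¼ cf Rt v²` by Young's inequality). -/
theorem main_form_lower :
    ∀ {H r S Rt Dr Q A lam v h f cf : ℝ}, 0 < S → r ^ 2 ≤ S → Dr ≤ 1 → 0 ≤ Q → A ^ 2 ≤ Q * Dr →
      1 / 4 ≤ H → H ≤ 5 / 4 → 0 < Rt → 1 / 2 ≤ cf → cf ≤ 3 / 2 → 32 ≤ h * (S * Rt) →
      16 ≤ f * (S * Rt) →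
      h / 4 * lam ^ 2 + f / 8 * Q + cf * Rt / 2 * v ^ 2 ≤
        2 * H * h * lam ^ 2 + f / 2 * Q + cf * Rt * v ^ 2 - cf * (4 * H * r / S) * lam * v +
          cf * (2 * r / S) * v * A := by
  intro H r S Rt Dr Q A lam v h f cf hS hrS hDr1 hQ hCS hH0 hH1 hRt hcf0 hcf1 hh hf
  have hcf : 0 ≤ cf := by linarith
  have hH : 0 ≤ H := by linarith
  have hSR : 0 < S * Rt := mul_pos hS hRt
  have hh0 : 0 ≤ h := by
    by_contra hneg
    have : h * (S * Rt) ≤ 0 := mul_nonpos_of_nonpos_of_nonneg (le_of_lt (not_le.1 hneg)) hSR.le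
    linarith
  -- Young's inequality for the two cross terms (multiplied by `S² Rt`, with the weight `cf`)
  have y1 : cf * (4 * H * r * (S * Rt) * lam * v) ≤
      cf * ((S * Rt) ^ 2 / 4 * v ^ 2 + 16 * H ^ 2 * r ^ 2 * lam ^ 2) := by
    refine mul_le_mul_of_nonneg_left ?_ hcf
    nlinarith [sq_nonneg (S * Rt * v / 2 - 4 * H * r * lam)]
  have y2 : cf * (-(2 * r * (S * Rt) * v * A)) ≤
      cf * ((S * Rt) ^ 2 / 4 * v ^ 2 + 4 * r ^ 2 * A ^ 2) := by
    refine mul_le_mul_of_nonneg_left ?_ hcf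
    nlinarith [sq_nonneg (S * Rt * v / 2 + 2 * r * A)]
  -- absorption of `4 cf r² A²` by `(3/8) f S² Rt Q`
  have c1 : r ^ 2 * A ^ 2 ≤ S * Q := by
    have h1 : r ^ 2 * A ^ 2 ≤ r ^ 2 * (Q * Dr) := mul_le_mul_of_nonneg_left hCS (sq_nonneg r)
    have h2 : r ^ 2 * (Q * Dr) ≤ r ^ 2 * Q := by
      have : 0 ≤ r ^ 2 * Q * (1 - Dr) := mul_nonneg (mul_nonneg (sq_nonneg r) hQ) (by linarith)
      linarith
    have h3 : r ^ 2 * Q ≤ S * Q := mul_le_mul_of_nonneg_right hrS hQ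
    linarith
  have c2 : 4 * cf * (r ^ 2 * A ^ 2) ≤ 6 * (S * Q) := by
    have e1 : 4 * cf * (r ^ 2 * A ^ 2) ≤ 4 * cf * (S * Q) :=
      mul_le_mul_of_nonneg_left c1 (by linarith)
    have e2 : 4 * cf * (S * Q) ≤ 6 * (S * Q) :=
      mul_le_mul_of_nonneg_right (by linarith) (mul_nonneg hS.le hQ)
    linarith
  have c3 : 16 * (S * Q) ≤ f * (S * Rt) * (S * Q) :=
    mul_le_mul_of_nonneg_right hf (mul_nonneg hS.le hQ)
  -- absorption of `16 cf H² r² λ²` by `H h S² Rt λ²`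
  have c4 : 16 * cf * H ^ 2 * r ^ 2 * lam ^ 2 ≤ 30 * H * (S * lam ^ 2) := by
    have e : 30 * H * (S * lam ^ 2) - 16 * cf * H ^ 2 * r ^ 2 * lam ^ 2 =
        H * lam ^ 2 * ((30 - 16 * cf * H) * S + 16 * cf * H * (S - r ^ 2)) := by ring
    have hcH : cf * H ≤ 15 / 8 := by
      have : 0 ≤ (3 / 2 - cf) * H := mul_nonneg (by linarith) hH
      nlinarith [this]
    have h1 : 0 ≤ (30 - 16 * cf * H) * S := mul_nonneg (by linarith) hS.le
    have h2 : 0 ≤ 16 * cf * H * (S - r ^ 2) :=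
      mul_nonneg (mul_nonneg (mul_nonneg (by norm_num) hcf) hH) (by linarith)
    have h3 : 0 ≤ H * lam ^ 2 * ((30 - 16 * cf * H) * S + 16 * cf * H * (S - r ^ 2)) :=
      mul_nonneg (mul_nonneg hH (sq_nonneg lam)) (add_nonneg h1 h2)
    linarith
  have c5 : 32 * (H * (S * lam ^ 2)) ≤ h * (S * Rt) * (H * (S * lam ^ 2)) :=
    mul_le_mul_of_nonneg_right hh (mul_nonneg hH (mul_nonneg hS.le (sq_nonneg lam)))
  have c6 : h * (S * Rt) * (H * (S * lam ^ 2)) ≤ (2 * H - 4⁻¹) * h * (S * Rt) * (S * lam ^ 2) := by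
    have : 0 ≤ (H - 4⁻¹) * (h * (S * Rt)) * (S * lam ^ 2) :=
      mul_nonneg (mul_nonneg (by linarith) (by linarith)) (mul_nonneg hS.le (sq_nonneg lam))
    linarith
  have c7 : 0 ≤ H * (S * lam ^ 2) := mul_nonneg hH (mul_nonneg hS.le (sq_nonneg lam))
  -- clear the denominator `S` and the factor `Rt`
  rw [← sub_nonneg]
  have key : 2 * H * h * lam ^ 2 + f / 2 * Q + cf * Rt * v ^ 2 - cf * (4 * H * r / S) * lam * v +
        cf * (2 * r / S) * v * A - (h / 4 * lam ^ 2 + f / 8 * Q + cf * Rt / 2 * v ^ 2) =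
      ((2 * H - 4⁻¹) * h * (S * Rt) * (S * lam ^ 2) + 3 / 8 * (f * (S * Rt)) * (S * Q) +
          cf / 2 * (S * Rt) ^ 2 * v ^ 2 - cf * (4 * H * r * (S * Rt) * lam * v) +
        cf * (2 * r * (S * Rt) * v * A)) / (S ^ 2 * Rt) := by
    field_simp
    ring
  rw [key]
  refine div_nonneg ?_ (by positivity)
  linarith [y1, y2, c2, c3, c4, c5, c6, c7]


/-! ### Absolute-value bookkeeping and the collar smallness estimates -/

/-- `k·z ≥ −K·Z` as soon as `|k| ≤ K` and `|z| ≤ Z`. -/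
theorem neg_mul_le_mul_of_abs_le {k K z Z : ℝ} (hk : |k| ≤ K) (hz : |z| ≤ Z) :
    -(K * Z) ≤ k * z := by
  have h1 : |k * z| ≤ K * Z := by
    rw [abs_mul]; exact mul_le_mul hk hz (abs_nonneg _) ((abs_nonneg k).trans hk)
  linarith [neg_abs_le (k * z)]

/-- A quadratic form with bounded coefficients: `|α λ² + β λv + γ v²| ≤ α λ² + B_β |λ||v| + B_γ v²`
for `α ≥ 0`, `|β| ≤ B_β`, `|γ| ≤ B_γ`. -/
theorem abs_quad_le {α β γ Bβ Bγ lam v : ℝ} (hα : 0 ≤ α) (hβ : |β| ≤ Bβ) (hγ : |γ| ≤ Bγ) :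
    |α * lam ^ 2 + β * (lam * v) + γ * v ^ 2| ≤ α * lam ^ 2 + Bβ * (|lam| * |v|) + Bγ * v ^ 2 := by
  have h1 : |β * (lam * v)| ≤ Bβ * (|lam| * |v|) := by
    rw [abs_mul, abs_mul]; exact mul_le_mul_of_nonneg_right hβ (by positivity)
  have h2 : |γ * v ^ 2| ≤ Bγ * v ^ 2 := by
    rw [abs_mul, abs_of_nonneg (sq_nonneg v)]; exact mul_le_mul_of_nonneg_right hγ (sq_nonneg v)
  have h3 : 0 ≤ α * lam ^ 2 := mul_nonneg hα (sq_nonneg _)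
  rw [abs_le]
  constructor
  · linarith [neg_abs_le (β * (lam * v)), neg_abs_le (γ * v ^ 2)]
  · linarith [le_abs_self (β * (lam * v)), le_abs_self (γ * v ^ 2)]

/-- A linear form with bounded coefficients: `|β λ + γ v| ≤ B_β |λ| + B_γ |v|`. -/
theorem abs_lin_le {β γ Bβ Bγ lam v : ℝ} (hβ : |β| ≤ Bβ) (hγ : |γ| ≤ Bγ) :
    |β * lam + γ * v| ≤ Bβ * |lam| + Bγ * |v| := by
  calc |β * lam + γ * v| ≤ |β * lam| + |γ * v| := abs_add_le _ _
    _ = |β| * |lam| + |γ| * |v| := by rw [abs_mul, abs_mul]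
    _ ≤ Bβ * |lam| + Bγ * |v| := by gcongr

/-- On the collar `|r − (M + s)| ≤ s/5000` (`s = √(M² − a²)`, so `a² + s² = M²`):
`|Δ| = |r² − 2Mr + a²| ≤ s²/2000` (`Δ = (r − M − s)(r − M + s)`). -/
theorem abs_delta_le {M s r a : ℝ} (hs : 0 < s) (has : a ^ 2 + s ^ 2 = M ^ 2)
    (ht : |r - (M + s)| ≤ 1 / 10000 * (2 * s)) :
    |r ^ 2 - 2 * M * r + a ^ 2| ≤ s ^ 2 / 2000 := by
  obtain ⟨ht1, ht2⟩ := abs_le.1 ht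
  have e : r ^ 2 - 2 * M * r + a ^ 2 = (r - (M + s)) ^ 2 + 2 * s * (r - (M + s)) := by
    linear_combination has
  rw [e, abs_le]
  constructor
  · nlinarith [sq_nonneg (r - (M + s)),
      mul_nonneg hs.le (by linarith : 0 ≤ r - (M + s) + 1 / 10000 * (2 * s))]
  · have h1 : (r - (M + s)) ^ 2 ≤ (1 / 10000 * (2 * s)) ^ 2 := by
      nlinarith [mul_nonneg (sub_nonneg.2 ht2)
        (by linarith : 0 ≤ r - (M + s) + 1 / 10000 * (2 * s))]
    nlinarith [mul_le_mul_of_nonneg_left ht2 hs.le]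

/-- On the collar: the `K`-misalignment coefficient `a − (r² + a²) ω₊`, `ω₊ = a/(2M(M + s))`,
equals `a((M + s)² − r²)/(2M(M + s))` and is bounded by `s/4000`. -/
theorem abs_eps1_num_le {M s r a : ℝ} (hM : 0 < M) (hs : 0 < s) (has : a ^ 2 + s ^ 2 = M ^ 2)
    (ht : |r - (M + s)| ≤ 1 / 10000 * (2 * s)) :
    |a - (r ^ 2 + a ^ 2) * (a / (2 * M * (M + s)))| ≤ s / 4000 := by
  obtain ⟨ht1, ht2⟩ := abs_le.1 ht
  have hMs : 0 < M + s := by linarith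
  have hden : 0 < 2 * M * (M + s) := by positivity
  have e : a - (r ^ 2 + a ^ 2) * (a / (2 * M * (M + s))) =
      a * ((M + s) ^ 2 - r ^ 2) / (2 * M * (M + s)) := by
    field_simp
    linear_combination (-a) * has
  have ha2 : a ^ 2 ≤ M ^ 2 := by nlinarith
  have haM : |a| ≤ M := abs_le_of_sq_le_sq ha2 hM.le
  have hX : |(M + s) ^ 2 - r ^ 2| ≤ s * (M + s) / 2000 := by
    have eX : (M + s) ^ 2 - r ^ 2 = -(2 * (M + s) * (r - (M + s))) - (r - (M + s)) ^ 2 := by ring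
    rw [eX, abs_le]
    have h1 : (r - (M + s)) ^ 2 ≤ (1 / 10000 * (2 * s)) ^ 2 := by
      nlinarith [mul_nonneg (sub_nonneg.2 ht2)
        (by linarith : 0 ≤ r - (M + s) + 1 / 10000 * (2 * s))]
    constructor
    · nlinarith [mul_le_mul_of_nonneg_left ht2 hMs.le]
    · nlinarith [mul_le_mul_of_nonneg_left ht1 hMs.le, sq_nonneg (r - (M + s))]
  rw [e, abs_div, abs_mul, abs_of_pos hden, div_le_iff₀ hden]
  calc |a| * |(M + s) ^ 2 - r ^ 2| ≤ M * (s * (M + s) / 2000) :=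
        mul_le_mul haM hX (abs_nonneg _) hM.le
    _ = s / 4000 * (2 * M * (M + s)) := by ring

/-- The axial component `Π = x₁p₂ − x₂p₁` in terms of the frame: from `Π (1 − c ω₊) = B − c λ` with
`|c| ≤ |a| ≤ M`, `|ω₊| ≤ |a|/(2M(M + s))` (so `|c ω₊| ≤ ½`): `|Π| ≤ 2|B| + 2M|λ|`. -/
theorem abs_Pi_le {M s a c om B lam Pi : ℝ} (hM : 0 < M) (hs : 0 < s)
    (has : a ^ 2 + s ^ 2 = M ^ 2) (hc : c ^ 2 ≤ a ^ 2) (hom : om = a / (2 * M * (M + s)))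
    (hPi : Pi * (1 - c * om) = B - c * lam) :
    |Pi| ≤ 2 * |B| + 2 * M * |lam| := by
  have ha2 : a ^ 2 ≤ M ^ 2 := by nlinarith
  have haM : |a| ≤ M := abs_le_of_sq_le_sq ha2 hM.le
  have hca : |c| ≤ |a| := sq_le_sq.1 hc
  have hcM : |c| ≤ M := hca.trans haM
  have hden : 0 < 2 * M * (M + s) := by positivity
  have hco : |c * om| ≤ 1 / 2 := by
    rw [hom, abs_mul, abs_div, abs_of_pos hden, ← mul_div_assoc, div_le_iff₀ hden]
    calc |c| * |a| ≤ M * M := mul_le_mul hcM haM (abs_nonneg _) hM.le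
      _ ≤ 1 / 2 * (2 * M * (M + s)) := by nlinarith
  have hk : 1 / 2 ≤ 1 - c * om := by linarith [le_abs_self (c * om)]
  have hpos : 0 < 1 - c * om := by linarith
  have h1 : |Pi| * (1 / 2) ≤ |Pi| * (1 - c * om) := mul_le_mul_of_nonneg_left hk (abs_nonneg _)
  have h2 : |Pi| * (1 - c * om) = |B - c * lam| := by
    rw [← hPi, abs_mul, abs_of_pos hpos]
  have h3 : |B - c * lam| ≤ |B| + M * |lam| := by
    calc |B - c * lam| ≤ |B| + |c * lam| := abs_sub _ _
      _ = |B| + |c| * |lam| := by rw [abs_mul]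
      _ ≤ |B| + M * |lam| := by gcongr
  linarith

/-- The product of the `Π`-bound and the `W`-bound in budget form:
`(2|B| + 2M|λ|)(64|λ|/s + 3|v|/M) ≤ (134 S Q + 195 S λ²)/s² + 6 v²`
for `0 < s ≤ M`, `M² ≤ S`, `B² ≤ 2SQ` (three Young inequalities). -/
theorem prod_PW_le {M s S Q B lam v : ℝ} (hM : 0 < M) (hs : 0 < s) (hsM : s ≤ M) (hMS : M ^ 2 ≤ S)
    (hQ : 0 ≤ Q) (hB : B ^ 2 ≤ 2 * S * Q) :
    (2 * |B| + 2 * M * |lam|) * (64 / s * |lam| + 3 / M * |v|) ≤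
      (134 * S * Q + 195 * S * lam ^ 2) / s ^ 2 + 6 * v ^ 2 := by
  have hS : 0 < S := lt_of_lt_of_le (by positivity) hMS
  have eB : |B| ^ 2 = B ^ 2 := sq_abs B
  have el : (M * |lam|) ^ 2 = M ^ 2 * lam ^ 2 := by rw [mul_pow, sq_abs]
  have ev : (M * |v|) ^ 2 = M ^ 2 * v ^ 2 := by rw [mul_pow, sq_abs]
  have y1 : 2 * M * (|B| * |lam|) ≤ 2 * S * Q + M ^ 2 * lam ^ 2 := by
    linarith [sq_nonneg (|B| - M * |lam|)]
  have y2 : 2 * M * (|B| * |v|) ≤ 2 * S * Q + M ^ 2 * v ^ 2 := by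
    linarith [sq_nonneg (|B| - M * |v|)]
  have y3 : 2 * (|lam| * |v|) ≤ lam ^ 2 + v ^ 2 := by
    linarith [sq_nonneg (|lam| - |v|), sq_abs lam, sq_abs v]
  have hsS : s ^ 2 ≤ S := (pow_le_pow_left₀ hs.le hsM 2).trans hMS
  have hMsS : M * s ≤ S := (mul_le_mul_of_nonneg_left hsM hM.le).trans (by rw [← pow_two]; exact hMS)
  have hSQ : 0 ≤ S * Q := mul_nonneg hS.le hQ
  -- the four monomials of the product, scaled by `M s`
  have p1 : 128 * M ^ 2 * s * (|B| * |lam|) ≤ 128 * M ^ 2 * (S * Q) + 64 * M ^ 2 * S * lam ^ 2 := by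
    have h := mul_le_mul_of_nonneg_left y1 (by positivity : (0 : ℝ) ≤ 64 * M * s)
    have h2 : 128 * M * s * (S * Q) ≤ 128 * M * M * (S * Q) :=
      mul_le_mul_of_nonneg_right (mul_le_mul_of_nonneg_left hsM (by positivity)) hSQ
    have h3 : 64 * M ^ 2 * (M * s) * lam ^ 2 ≤ 64 * M ^ 2 * S * lam ^ 2 :=
      mul_le_mul_of_nonneg_right (mul_le_mul_of_nonneg_left hMsS (by positivity)) (sq_nonneg _)
    linarith [h, h2, h3]
  have p2 : 6 * M * s ^ 2 * (|B| * |v|) ≤ 6 * M ^ 2 * (S * Q) + 3 * M ^ 2 * s ^ 2 * v ^ 2 := by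
    have h := mul_le_mul_of_nonneg_left y2 (by positivity : (0 : ℝ) ≤ 3 * s ^ 2)
    have h2 : 6 * s ^ 2 * (S * Q) ≤ 6 * M ^ 2 * (S * Q) :=
      mul_le_mul_of_nonneg_right
        (mul_le_mul_of_nonneg_left (pow_le_pow_left₀ hs.le hsM 2) (by norm_num)) hSQ
    linarith [h, h2]
  have p3 : 128 * M ^ 3 * s * lam ^ 2 ≤ 128 * M ^ 2 * S * lam ^ 2 := by
    have : 128 * M ^ 2 * (M * s) * lam ^ 2 ≤ 128 * M ^ 2 * S * lam ^ 2 :=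
      mul_le_mul_of_nonneg_right (mul_le_mul_of_nonneg_left hMsS (by positivity)) (sq_nonneg _)
    linarith [this]
  have p4 : 6 * M ^ 2 * s ^ 2 * (|lam| * |v|) ≤ 3 * M ^ 2 * S * lam ^ 2 + 3 * M ^ 2 * s ^ 2 * v ^ 2 := by
    have h := mul_le_mul_of_nonneg_left y3 (by positivity : (0 : ℝ) ≤ 3 * M ^ 2 * s ^ 2)
    have h2 : 3 * M ^ 2 * s ^ 2 * lam ^ 2 ≤ 3 * M ^ 2 * S * lam ^ 2 :=
      mul_le_mul_of_nonneg_right (mul_le_mul_of_nonneg_left hsS (by positivity)) (sq_nonneg _)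
    linarith [h, h2]
  have hl2 : |lam| ^ 2 = lam ^ 2 := sq_abs lam
  rw [← sub_nonneg]
  have key : (134 * S * Q + 195 * S * lam ^ 2) / s ^ 2 + 6 * v ^ 2 -
      (2 * |B| + 2 * M * |lam|) * (64 / s * |lam| + 3 / M * |v|) =
      (134 * M ^ 2 * (S * Q) + 195 * M ^ 2 * S * lam ^ 2 + 6 * M ^ 2 * s ^ 2 * v ^ 2 -
        (128 * M ^ 2 * s * (|B| * |lam|) + 6 * M * s ^ 2 * (|B| * |v|) +
          128 * M ^ 3 * s * |lam| ^ 2 + 6 * M ^ 2 * s ^ 2 * (|lam| * |v|))) / (M ^ 2 * s ^ 2) := by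
    field_simp
    ring
  rw [key, hl2]
  exact div_nonneg (by linarith [p1, p2, p3, p4]) (by positivity)

end Summit.FinalStateConjecture.FinalStateConjecture.Theorems.NearExtremalKappaCapture.UnitTemperatureFrontFace

end
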